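import Summits.Ventures.PercRepro.S1CircuitLadderB

/-!
# PercRepro — THE SHARP FOUR-CIRCUIT COUNT AT BOUNDED NULLITY, PART A: the parallel-pair count with a circuit present and
the triangles through a point off the lines of a triangle (p8, gen 19; a feeder for S4 — the top of the `q = 7` window, the
rows `66` and below)

LEMMA T4 (`S1.three_mul_ncard_four_circuits_le`: `3·s₄ ≤ ν(ν+1)(ν+2)`) charges the `4`-circuits through a point `e` to the
triangles of `M ／ {e}`, a matroid whose lines have `≤ 5` points, counted by the ladder's `s₃ ≤ ν(ν + 1)` — which pays
`t_x ≤ 2ν` at every step of its deletion induction. The same «+1» as in S1TriangleCountSharp, one rung up, needs the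
two rungs below sharpened first:
* **`two_mul_ncard_two_circuits_add_le`** — the parallel-pair count with a circuit of `≥ 3` elements present:
  `2·#(2-circuits) + a ≤ a·ν` (the class-deletion induction of `two_mul_ncard_two_circuits_le` with the representative
  of the deleted class taken ON the circuit, which meets a class in at most one point, so the circuit survives);
* **`two_mul_ncard_trianglesThrough_add_le`** — if a triangle `T` avoids every line through the non-loop `x`
  (`x ∉ cl T`), then `2·t_x + a ≤ a·ν` (`T` is a circuit of `M ／ {x}`: its pairs together with `x` are independent).
Part B (S1FourCircuitCountSharpB) counts the triangles of a matroid with lines `≤ 5` points by `s₃ ≤ ν² − ν + 4`; Part C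
(S1FourCircuitCountSharpC) gives `3·s₄ ≤ ν³ + 11ν`. Axioms: standard.
-/

open scoped Matroid

namespace PercRepro

namespace S1

open Set

variable {α : Type}

/-- A `3`-element circuit has rank `2`. -/
theorem eRk_eq_two_of_ncard_three_circuit (M : Matroid α) [M.Finite] {C : Set α}
    (hC : M.IsCircuit C) (hC3 : C.ncard = 3) : M.eRk C = 2 := by
  have hfin : C.Finite := M.ground_finite.subset hC.subset_ground
  have h := hC.eRk_add_one_eq
  rw [← hfin.cast_ncard_eq, hC3] at h
  have hne : M.eRk C ≠ ⊤ := ((M.eRk_le_encard _).trans_lt hfin.encard_lt_top).ne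
  obtain ⟨r, hr⟩ := ENat.ne_top_iff_exists.1 hne
  rw [← hr] at h ⊢
  have h' : r + 1 = 3 := by exact_mod_cast h
  have : r = 2 := by omega
  rw [this]; norm_num

/-- **The parallel-pair count with a circuit present**: if `|E| = r(E) + d`, every set of rank `≤ 1` has at most `a`
points and `K` has a circuit `T` with `≥ 3` elements, then `2·#(2-circuits) + a ≤ a·d`. The class-deletion induction of
`two_mul_ncard_two_circuits_le` with the representative of the deleted class taken ON `T` when `T` meets it (it meets
it in at most one point, its pairs being independent), so that `T` is a circuit of the smaller matroid. -/
theorem two_mul_ncard_two_circuits_add_le (K : Matroid α) [K.Finite] (a : ℕ)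
    (h1 : ∀ L ⊆ K.E, K.eRk L ≤ 1 → L.ncard ≤ a) {T : Set α} (hT : K.IsCircuit T) (hT3 : 3 ≤ T.ncard)
    {d : ℕ} (hd : K.E.encard = K.eRank + d) :
    2 * {C : Set α | K.IsCircuit C ∧ C.ncard = 2}.ncard + a ≤ a * d := by
  suffices H : ∀ n : ℕ, ∀ (K : Matroid α) [K.Finite], K.E.ncard = n →
      (∀ L ⊆ K.E, K.eRk L ≤ 1 → L.ncard ≤ a) → ∀ T : Set α, K.IsCircuit T → 3 ≤ T.ncard →
      ∀ d : ℕ, K.E.encard = K.eRank + d →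
      2 * {C : Set α | K.IsCircuit C ∧ C.ncard = 2}.ncard + a ≤ a * d from H _ K rfl h1 T hT hT3 d hd
  intro n
  induction n using Nat.strong_induction_on with
  | _ n ih =>
  intro K _ hn h1 T hT hT3 d hd
  classical
  set S := {C : Set α | K.IsCircuit C ∧ C.ncard = 2} with hS
  have hSfin : S.Finite :=
    K.ground_finite.finite_subsets.subset (fun C hC => hC.1.subset_ground)
  -- `d ≥ 1`: the circuit `T` makes `E` dependent
  have hd1 : 1 ≤ d := by
    by_contra h0
    have hd0 : d = 0 := by omega
    rw [hd0, Nat.cast_zero, add_zero, Matroid.eRank_def] at hd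
    have hEind : K.Indep K.E := (Matroid.indep_iff_eRk_eq_encard_of_finite K.ground_finite).2 hd.symm
    exact hT.dep.not_indep (hEind.subset hT.subset_ground)
  by_cases hSe : S = ∅
  · rw [hSe, ncard_empty, mul_zero, zero_add]
    calc a = a * 1 := (mul_one a).symm
      _ ≤ a * d := Nat.mul_le_mul_left a hd1
  obtain ⟨C₀, hC₀⟩ := nonempty_iff_ne_empty.2 hSe
  obtain ⟨a₀, b, hab, hC₀ab⟩ := ncard_eq_two.1 hC₀.2
  have haC₀ : a₀ ∈ C₀ := by rw [hC₀ab]; exact mem_insert a₀ {b}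
  have hbC₀ : b ∈ C₀ := by rw [hC₀ab]; exact mem_insert_of_mem a₀ rfl
  have haE : a₀ ∈ K.E := hC₀.1.subset_ground haC₀
  have hanl : K.IsNonloop a₀ := by
    refine Matroid.isNonloop_of_not_isLoop haE ?_
    intro hloop
    have h := hloop.eq_of_isCircuit_mem hC₀.1 haC₀
    have h2 := hC₀.2
    rw [h, ncard_singleton] at h2
    omega
  have hrfin : K.eRank ≠ ⊤ := PercRepro.Matroid.eRank_ne_top_of_finite K
  obtain ⟨r, hr⟩ := ENat.ne_top_iff_exists.1 hrfin
  have hEn : K.E.ncard = r + d := by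
    have h := hd
    rw [← hr, ← K.ground_finite.cast_ncard_eq] at h
    exact_mod_cast h
  set P := K.closure {a₀} with hP
  have hPE : P ⊆ K.E := K.closure_subset_ground _
  have hPfin : P.Finite := K.ground_finite.subset hPE
  have haP : a₀ ∈ P := K.mem_closure_self a₀ haE
  have hPr : K.eRk P ≤ 1 := by
    rw [hP, K.eRk_closure_eq, hanl.eRk_eq]
  have hPcard : P.ncard ≤ a := h1 P hPE hPr
  have hbP : b ∈ P := by
    have h := hC₀.1.mem_closure_sdiff_singleton_of_mem hbC₀
    have h2 : C₀ \ {b} = {a₀} := by rw [hC₀ab, pair_sdiff_right hab]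
    rw [h2] at h
    exact h
  -- `T` meets the class `P` in at most one point (its pairs are independent, `P` has rank `≤ 1`)
  have hTP : ∀ t ∈ T, ∀ t' ∈ T, t ∈ P → t' ∈ P → t = t' := by
    intro t ht t' ht' htP ht'P
    by_contra hne
    have hpair : ({t, t'} : Set α) ⊂ T := by
      refine (insert_subset ht (singleton_subset_iff.2 ht')).ssubset_of_ne ?_
      intro h
      have := congrArg ncard h
      rw [ncard_pair hne] at this
      omega
    have hind : K.Indep ({t, t'} : Set α) := hT.ssubset_indep hpair
    have h2 : K.eRk ({t, t'} : Set α) ≤ 1 :=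
      (K.eRk_mono (insert_subset htP (singleton_subset_iff.2 ht'P))).trans hPr
    rw [hind.eRk_eq_encard, encard_pair hne] at h2
    have h3 : (2 : ℕ) ≤ 1 := by exact_mod_cast h2
    omega
  -- the representative of the class: the point of `T` in `P` if there is one, else `a₀`
  obtain ⟨a₁, ha₁P, ha₁nl, ha₁T⟩ : ∃ a₁ ∈ P, K.IsNonloop a₁ ∧ ∀ t ∈ T, t ∈ P → t = a₁ := by
    by_cases h : ∃ t ∈ T, t ∈ P
    · obtain ⟨t, htT, htP⟩ := h
      refine ⟨t, htP, ?_, fun t' ht' ht'P => hTP t' ht' t htT ht'P htP⟩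
      refine Matroid.isNonloop_of_not_isLoop (hT.subset_ground htT) ?_
      intro hloop
      have h := hloop.eq_of_isCircuit_mem hT htT
      rw [h, ncard_singleton] at hT3
      omega
    · exact ⟨a₀, haP, hanl, fun t ht htP => absurd ⟨t, ht, htP⟩ h⟩
  have ha₁E : a₁ ∈ K.E := hPE ha₁P
  have hcl₁ : K.closure {a₁} = P := ha₁nl.closure_eq_of_mem_closure ha₁P
  set D := P \ {a₁} with hD
  have hDP : D ⊆ P := sdiff_subset
  have ha₁D : a₁ ∉ D := fun h => h.2 rfl
  have hDE : D ⊆ K.E := hDP.trans hPE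
  have hDfin : D.Finite := hPfin.subset hDP
  have hDcl : D ⊆ K.closure {a₁} := by rw [hcl₁]; exact hDP
  have hDne : D.Nonempty := by
    by_cases h : a₀ = a₁
    · exact ⟨b, hbP, fun hb => hab (h.trans (mem_singleton_iff.1 hb).symm)⟩
    · exact ⟨a₀, haP, fun ha => h (mem_singleton_iff.1 ha)⟩
  set m := D.ncard with hm
  have hm1 : 1 ≤ m := by
    rw [hm]; exact Nat.one_le_iff_ne_zero.2 (by rw [Ne, ncard_eq_zero hDfin]; exact hDne.ne_empty)
  have hPm : P.ncard = m + 1 := by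
    rw [hm, hD, ncard_sdiff_singleton_add_one ha₁P hPfin]
  have hma : m + 1 ≤ a := by omega
  set K' := K ＼ D with hK'
  have hK'rank : K'.eRank = K.eRank := eRank_delete_eq_of_subset_closure K ha₁E ha₁D hDcl
  have hK'E : K'.E = K.E \ D := Matroid.delete_ground K D
  have hK'card : K'.E.ncard + m = K.E.ncard := by
    rw [hK'E, hm]
    have h := encard_sdiff_add_encard_of_subset hDE
    rw [← (K.ground_finite.subset sdiff_subset).cast_ncard_eq, ← hDfin.cast_ncard_eq,
      ← K.ground_finite.cast_ncard_eq] at h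
    exact_mod_cast h
  have hK'lt : K'.E.ncard < n := by rw [← hn]; omega
  have hmd : m ≤ d := by
    have h := K'.eRk_le_encard K'.E
    rw [← Matroid.eRank_def, hK'rank, ← hr, ← (K.ground_finite.subset (hK'E ▸ sdiff_subset)).cast_ncard_eq] at h
    have h' : r ≤ K'.E.ncard := by exact_mod_cast h
    omega
  have hd' : K'.E.encard = K'.eRank + ((d - m : ℕ) : ℕ∞) := by
    rw [hK'rank, ← hr, ← (K.ground_finite.subset (hK'E ▸ sdiff_subset)).cast_ncard_eq]
    have : K'.E.ncard = r + (d - m) := by omega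
    rw [this]; push_cast; rfl
  have h1' : ∀ L ⊆ K'.E, K'.eRk L ≤ 1 → L.ncard ≤ a := by
    intro L hL hr
    rw [hK'E] at hL
    rw [hK', Matroid.delete_eq_restrict, Matroid.restrict_eRk_eq _ hL] at hr
    exact h1 L (hL.trans sdiff_subset) hr
  -- `T` survives the deletion
  have hTD : Disjoint T D := by
    rw [disjoint_left]
    intro t ht htD
    exact htD.2 (mem_singleton_iff.2 (ha₁T t ht (hDP htD)))
  have hT' : K'.IsCircuit T := Matroid.delete_isCircuit_iff.2 ⟨hT, hTD⟩
  set S₁ := {C : Set α | C ⊆ P ∧ C.ncard = 2} with hS₁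
  set S₂ := {C : Set α | K'.IsCircuit C ∧ C.ncard = 2} with hS₂
  have hsplit : S ⊆ S₁ ∪ S₂ := by
    intro C hC
    by_cases hCD : Disjoint C D
    · exact Or.inr ⟨Matroid.delete_isCircuit_iff.2 ⟨hC.1, hCD⟩, hC.2⟩
    · left
      refine ⟨?_, hC.2⟩
      obtain ⟨u, huC, huD⟩ := not_disjoint_iff.1 hCD
      have huP : u ∈ P := hDP huD
      have hCfin : C.Finite := K.ground_finite.subset hC.1.subset_ground
      have hunl : K.IsNonloop u := by
        refine Matroid.isNonloop_of_not_isLoop (hC.1.subset_ground huC) ?_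
        intro hloop
        have h := hloop.eq_of_isCircuit_mem hC.1 huC
        have h2 := hC.2
        rw [h, ncard_singleton] at h2
        omega
      have hcl : K.closure {u} = K.closure {a₀} := hunl.closure_eq_of_mem_closure huP
      intro v hvC
      by_cases hvu : v = u
      · rw [hvu]; exact huP
      · have hv : v ∈ K.closure (C \ {v}) := hC.1.mem_closure_sdiff_singleton_of_mem hvC
        have hCuv : ({u, v} : Set α) ⊆ C := insert_subset_iff.2 ⟨huC, singleton_subset_iff.2 hvC⟩
        have hCeq : C = {u, v} :=
          (eq_of_subset_of_ncard_le hCuv (by rw [hC.2, ncard_pair (Ne.symm hvu)]) hCfin).symm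
        have hCv : C \ {v} = {u} := by rw [hCeq, pair_sdiff_right (Ne.symm hvu)]
        rw [hCv, hcl] at hv
        exact hv
  have hS₁fin : S₁.Finite := hPfin.finite_subsets.subset (fun C hC => hC.1)
  have hS₂fin : S₂.Finite := K'.ground_finite.finite_subsets.subset (fun C hC => hC.1.subset_ground)
  have hS₁card : S₁.ncard ≤ (m + 1).choose 2 := by
    have hsub : S₁ ⊆ ((hPfin.toFinset.powersetCard 2).image (fun t : Finset α => (t : Set α)) : Set (Set α)) := by
      intro C hC
      have hCfin : C.Finite := hPfin.subset hC.1
      rw [Finset.coe_image]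
      refine ⟨hCfin.toFinset, ?_, by simp⟩
      rw [Finset.mem_coe, Finset.mem_powersetCard]
      refine ⟨?_, ?_⟩
      · intro x hx
        rw [Finite.mem_toFinset] at hx ⊢
        exact hC.1 hx
      · rw [← ncard_eq_toFinset_card C hCfin]; exact hC.2
    calc S₁.ncard ≤ ((hPfin.toFinset.powersetCard 2).image (fun t : Finset α => (t : Set α)) : Set (Set α)).ncard :=
          ncard_le_ncard hsub (Finset.finite_toSet _)
      _ = ((hPfin.toFinset.powersetCard 2).image (fun t : Finset α => (t : Set α))).card := ncard_coe_finset _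
      _ ≤ (hPfin.toFinset.powersetCard 2).card := Finset.card_image_le
      _ = (m + 1).choose 2 := by
          rw [Finset.card_powersetCard, ← hPm, ncard_eq_toFinset_card P hPfin]
  have hS₂card : 2 * S₂.ncard + a ≤ a * (d - m) := ih _ hK'lt K' rfl h1' T hT' hT3 (d - m) hd'
  have hchoose : 2 * (m + 1).choose 2 ≤ a * m := by
    have h := Nat.choose_two_right (m + 1)
    rw [h, show m + 1 - 1 = m by omega]
    have h2 : (m + 1) * m / 2 * 2 = (m + 1) * m := by
      apply Nat.div_mul_cancel
      rw [mul_comm]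
      exact (Nat.even_mul_succ_self m).two_dvd
    calc 2 * ((m + 1) * m / 2) = (m + 1) * m := by rw [mul_comm]; exact h2
      _ ≤ a * m := Nat.mul_le_mul_right m hma
  have hSS : S.ncard ≤ S₁.ncard + S₂.ncard :=
    (ncard_le_ncard hsplit (hS₁fin.union hS₂fin)).trans (ncard_union_le _ _)
  calc 2 * S.ncard + a ≤ 2 * S₁.ncard + (2 * S₂.ncard + a) := by omega
    _ ≤ 2 * (m + 1).choose 2 + a * (d - m) := by omega
    _ ≤ a * m + a * (d - m) := by omega
    _ = a * d := by rw [← Nat.mul_add, Nat.add_sub_cancel' hmd]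

/-- **The `3`-circuits through a point, a triangle off its lines**: if every rank-`2` set has `≤ a + 1` points, `x` is a
non-loop and `T` is a triangle with `x ∉ cl T`, then `2·#{3-circuits through x} + a ≤ a·d` — the triangles through `x`
inject into the `2`-circuits of `M ／ {x}`, where `T` is a circuit (its pairs together with `x` are independent). -/
theorem two_mul_ncard_trianglesThrough_add_le (M : Matroid α) [M.Finite] (a : ℕ)
    (hflat : ∀ X ⊆ M.E, M.eRk X ≤ 2 → X.ncard ≤ a + 1) {x : α} (hxI : M.Indep {x})
    {T : Set α} (hT : M.IsCircuit T) (hT3 : T.ncard = 3) (hxT : x ∉ M.closure T) {d : ℕ}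
    (hd : M.E.encard = M.eRank + d) :
    2 * {C : Set α | M.IsCircuit C ∧ C.ncard = 3 ∧ x ∈ C}.ncard + a ≤ a * d := by
  classical
  have hxE : x ∈ M.E := hxI.subset_ground (mem_singleton x)
  have hν : M✶.eRank = (d : ℕ∞) := dual_eRank_eq_of_encard M hd
  set N := M ／ {x} with hN
  have hNd : N.E.encard = N.eRank + d := by
    apply encard_eq_of_dual_eRank
    rw [hN, PercRepro.Matroid.dual_eRank_contract_singleton hxI, hν]
  have hNE : N.E = M.E \ {x} := _root_.Matroid.contract_ground M {x}
  have hN' : ∀ L ⊆ N.E, N.eRk L ≤ 1 → L.ncard ≤ a := by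
    intro L hL hr
    rw [hNE] at hL
    have heL : x ∉ L := fun h => (hL h).2 rfl
    have hLfin : L.Finite := M.ground_finite.subset (hL.trans sdiff_subset)
    have hins : M.eRk (insert x L) ≤ 2 := by
      have h := contract_singleton_eRk_add_one hxI hL
      rw [← hN] at h
      rw [← h]
      calc N.eRk L + 1 ≤ 1 + 1 := add_le_add_left hr 1
        _ = 2 := by norm_num
    have hb := hflat (insert x L) (insert_subset hxE (hL.trans sdiff_subset)) hins
    rw [ncard_insert_of_notMem heL hLfin] at hb
    omega
  -- `T` is a circuit of `N`
  have hTE : T ⊆ M.E := hT.subset_ground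
  have hTfin : T.Finite := M.ground_finite.subset hTE
  have hxnT : x ∉ T := fun h => hxT (M.subset_closure T hTE h)
  have hTr : M.eRk T = 2 := eRk_eq_two_of_ncard_three_circuit M hT hT3
  have hTN : N.IsCircuit T := by
    rw [Matroid.isCircuit_iff_dep_forall_sdiff_singleton_indep]
    refine ⟨?_, ?_⟩
    · rw [hN, hxI.contract_dep_iff]
      refine ⟨disjoint_singleton_right.2 hxnT, ?_⟩
      rw [Matroid.dep_iff]
      refine ⟨?_, union_subset hTE (singleton_subset_iff.2 hxE)⟩
      intro hind
      have h1 := hind.eRk_eq_encard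
      rw [union_singleton, encard_insert_of_notMem hxnT, ← hTfin.cast_ncard_eq, hT3] at h1
      have h2 := M.eRk_insert_le_add_one x T
      rw [h1, hTr] at h2
      have h3 : (3 : ℕ) + 1 ≤ 2 + 1 := by exact_mod_cast h2
      omega
    · intro e he
      rw [hN, hxI.contract_indep_iff]
      refine ⟨disjoint_singleton_right.2 (fun h => hxnT h.1), ?_⟩
      rw [union_singleton]
      have hind := hT.sdiff_singleton_indep he
      rw [hind.insert_indep_iff_of_notMem (fun h => hxnT h.1)]
      exact ⟨hxE, fun h => hxT (M.closure_subset_closure sdiff_subset h)⟩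
  have hT3' : 3 ≤ T.ncard := by omega
  set S₁ := {C : Set α | M.IsCircuit C ∧ C.ncard = 3 ∧ x ∈ C} with hS₁
  let f : Set α → Set α := fun C => C \ {x}
  have hmaps : ∀ C ∈ S₁, f C ∈ {C' : Set α | N.IsCircuit C' ∧ C'.ncard = 2} := by
    intro C hC
    have hCfin : C.Finite := M.ground_finite.subset hC.1.subset_ground
    refine ⟨hC.1.contractElem_isCircuit ?_ hC.2.2, ?_⟩
    · have h1lt : 1 < C.ncard := by rw [hC.2.1]; omega
      obtain ⟨y, hy, z, hz, hyz⟩ := (one_lt_ncard hCfin).1 h1lt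
      exact ⟨y, hy, z, hz, hyz⟩
    · have h3 := ncard_sdiff_singleton_add_one hC.2.2 hCfin
      have h4 := hC.2.1
      simp only [f]
      omega
  have hinj : InjOn f S₁ := by
    intro C hC C' hC' h
    have e1 : C = insert x (C \ {x}) := by rw [insert_sdiff_singleton, insert_eq_of_mem hC.2.2]
    have e2 : C' = insert x (C' \ {x}) := by rw [insert_sdiff_singleton, insert_eq_of_mem hC'.2.2]
    rw [e1, e2]
    simp only [f] at h
    rw [h]
  have hle : S₁.ncard ≤ {C' : Set α | N.IsCircuit C' ∧ C'.ncard = 2}.ncard :=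
    ncard_le_ncard_of_injOn f hmaps hinj
      (N.ground_finite.finite_subsets.subset (fun C hC => hC.1.subset_ground))
  have hinner := two_mul_ncard_two_circuits_add_le N a hN' hTN hT3' hNd
  omega

end S1

end PercRepro
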